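import Summits.BirchSwinnertonDyer.BirchSwinnertonDyer.Theorems.PrintX9JetchevX9SwapStep
import Summits.BirchSwinnertonDyer.BirchSwinnertonDyer.Theorems.PrintX9JetchevX9SwapPrime
import Summits.BirchSwinnertonDyer.BirchSwinnertonDyer.Theorems.Rank1ResidualJetSwapLevelRaising
import Summits.BirchSwinnertonDyer.BirchSwinnertonDyer.Theorems.Rank1ResidualJetSwapWalk
import Summits.BirchSwinnertonDyer.BirchSwinnertonDyer.Theorems.KolyvaginRoadThreeLevelData
import Summits.BirchSwinnertonDyer.BirchSwinnertonDyer.Theorems.Rank1ResidualJetCompatibleDataTriple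
import Summits.BirchSwinnertonDyer.BirchSwinnertonDyer.Theorems.Rank1ResidualJetSwapLevelRaisingLiterature
import Summits.BirchSwinnertonDyer.BirchSwinnertonDyer.Theorems.KatoDescentPotSupersingularWildJetchevBoundAtPHeegnerE0ImageFree
import Summits.BirchSwinnertonDyer.BirchSwinnertonDyer.Theorems.Rank1ResidualJetCarrierEndFormsLiteratureNoCV
import Summits.BirchSwinnertonDyer.BirchSwinnertonDyer.Theorems.Rank1ResidualJetKolyvaginLocalTermClosed
import Summits.BirchSwinnertonDyer.BirchSwinnertonDyer.Theorems.ClassRecordThreeEulerHalvesAtThreeWalkSupplyDisjoint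
import Summits.BirchSwinnertonDyer.BirchSwinnertonDyer.Theorems.Rank1ResidualJetWeilDatum
import Summits.BirchSwinnertonDyer.BirchSwinnertonDyer.Theorems.Rank1ResidualJetCoreVertexBridge
import Summits.BirchSwinnertonDyer.Rank1Residual.JET.RingClassTransverseLagrangian
import Summits.BirchSwinnertonDyer.Rank1Residual.JET.TransverseFamilyConjAct
import Literature.NumberTheory.EllipticCurves.HeegnerPointsKolyvaginExceptionalSelmerProofs
import Literature.NumberTheory.EllipticCurves.WeilPairingTateDual
import HarnessLib

/-!
# Route `PrintX9`, crux J = `HeegnerDivisibilityX9` (item 20392), stub `stub_jetchevX9` — the X9 SWAP assembled: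
# brick 4 (LEVEL RAISING AT MINIMAL DEPTH on an X9 Heegner frame, X9 twin of bsd-jet pv-2's
# `Swap.exists_conductor_levelIndex_ge_of_minDepth`) and **`swapX9_of_namedFacts` — Kolyvagin's prime swap (McCallum 1991
# Prop. 5.2, `C = {0}`) on every X9 Heegner frame FROM THREE NAMED LITERATURE FACTS** {Gross 3.7 (2), Poitou–Tate,
# [GZ86 III (3.1)] image-free} (X9 twin of `Swap.levelRaising_of_literature`)

Cell `bsd-print-x9` (print tier, key `x9`), prover seat p4; `--supports stmt-BirchSwinnertonDyer-20392`,
helper; THEOREMS ONLY, nothing booked, no item closed, BSD is not proved by any of this.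

WHAT. `exists_conductor_levelIndex_ge_of_minDepth_classX9`: for an X9 pair `(E, p)` (`ClassX9 W p`), `K` Heegner for `N_E`
with `p` split and `d_K ∉ {−3, −4}`, `τ ≠ 1`, a frame `(Dt, β, ι)`, the level-`p` Poitou–Tate package / Weil datum / global
intrinsic transverse family with the walk's local inputs (`hloc`, `hdisj`, `h𝒯σ`, `h𝒯sd`), Gross 3.7 (2) (`h37`), [GZ86 III
(3.1)] (`hGZ`, Kolyvagin-guarded receptacle shape), and a MINIMAL depth `u`: from ANY conductor `n₀` of Kolyvagin primes of
index `≥ 1 + u` with a datum `p^{u+1} ∤ P_{n₀}` and any bound `m'`, a conductor `n` of index `≥ max m' (1 + u)` with a datum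
`p^{u+1} ∤ P_n` — McCallum 1991 Prop. 5.2 (`C = {0}`). PROOF = bsd-jet's byte-for-byte: the walk
`Swap.exists_forall_le_index_of_swapStep` with one step = `exists_swapPrime_classX9` + `exists_compatible_data_triple_of_grossCM`
(image-free) + `not_dvd_of_swap_classX9`. CONDITIONAL on the displayed inputs (fed by name in the sequel); nothing asserted.
§2 WHAT. `swapX9_of_namedFacts h37 hPT hF1 : SwapX9` — the binder `hswapX9` of this seat's swap-keyed bridge
`JET.Split.jetchevX9_of_swapX9_of_namedFacts` (`PrintX9JetchevX9SwapBridge`: Kolyvagin's `r`-free prime swap quantified over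
the X9 Heegner frames, `Koly.PDiv` currency) PROVED from the three named Literature facts, by brick 4
`exists_conductor_levelIndex_ge_of_minDepth_classX9` (`PrintX9JetchevX9SwapLevelRaising`) with its level-`p` structural
inputs supplied exactly as in bsd-jet's brick 7: the Poitou–Tate package `inv` from `hPT K (p^1)`; a `τ`-equivariant Weil
datum (`JET.exists_weilDatum_liftAut`); the global intrinsic transverse family (`Walk.exists_globalTransverseFamily`) with
`h𝒯σ`, `h𝒯sd`, `hloc` (`kolyvaginLocalTerm_of_poitouTate`), `hdisj`; [GZ86 III (3.1)] guarded from the IMAGE-FREE fact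
(`HeegnerE0ImageFree.hGZ_of_Gross1991_imageFree hF1`, irreducibility gives `p ∤ #E(ℚ)_tors`); Prop. 4.4 from (γ) inside
bricks 2a/2b. The frame conversion `M + 1 = 1 + M`, `e ≤ max e (1 + M)` is bookkeeping. CONSEQUENCE (sequel
`PrintX9JetchevX9StubOfNamedFacts`): `stub_jetchevX9 ⟸ {Gross 3.7 (2), Poitou–Tate, GZ86 III (3.1) image-free}` — NO READING
LEFT in the single-carrier regime of crux J. CONDITIONAL on the three named facts; nothing asserted about any curve.
References (locators only): [cite: McCallumLMS1991, §5 Prop. 5.2 and proof (pp. 304–306), §4 Prop. 4.4] [cite: Jetchev2008,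
proof of Thm. 1.4 (p. 824), Lemma 5.1, Lemma 5.2, Thm. 5.1, Rem. 6.2] [cite: GrossLMS1991, §3–§4, Prop. 3.7 (2), §6 Prop. 6.2 (1)]
[cite: GrossZagier1986, III (3.1)] [cite: MilneADT2006, Ch. I, Thm. 4.10(b)].
-/

set_option autoImplicit false

noncomputable section

open scoped Classical Pointwise
open Function NumberField IsDedekindDomain WeierstrassCurve Field
open Literature.NumberTheory.EllipticCurves Literature.NumberTheory.GaloisRepresentations
open Literature.NumberTheory.EllipticCurves.Jetchev2008 Literature.NumberTheory.EllipticCurves.KolyvaginCocycle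
open Literature.NumberTheory.EllipticCurves.ModularForms
open Literature.NumberTheory.GaloisCohomology Literature.NumberTheory.Automorphic
open Literature.NumberTheory.GaloisRepresentations.DiscreteGaloisModule (transverseSubgroup SelmerStructure)
open Summit.BirchSwinnertonDyer.Rank1Residual.JET.SelmerVocabulary
open Summit.BirchSwinnertonDyer.Rank1Residual.JET.GlobalDuality
open Summit.BirchSwinnertonDyer.Rank1Residual.X11b
open Summit.BirchSwinnertonDyer.Rank1Residual.X11b.Three
open Summit.BirchSwinnertonDyer.BirchSwinnertonDyer.Theorems
open Literature.NumberTheory.EllipticCurves.Rank1Residual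
open Summit.BirchSwinnertonDyer.Rank1Residual.JET.Swap

namespace Summit.BirchSwinnertonDyer.Rank1Residual.JET.Split

variable {K : Type} [Field K] [NumberField K] (W : WeierstrassCurve ℚ) [W.IsElliptic]
  [W.IsGloballyMinimal] [NeZero (W.conductorNorm ℤ)]
  (τ : K ≃ₐ[ℚ] K) (p : ℕ) [Fact p.Prime] [NeZero (p ^ 1)]
  [Finite (geomTorsion (W.baseChange K) ((p ^ 1 : ℕ) : ℤ))]
  (e : geomTorsion (W.baseChange K) ((p ^ 1 : ℕ) : ℤ) → geomTorsion (W.baseChange K) ((p ^ 1 : ℕ) : ℤ) →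
    AlgebraicClosure K)
  (hμ : ∀ S T, e S T ^ (p ^ 1) = 1)
  (hadd₁ : ∀ S₁ S₂ T, e (S₁ + S₂) T = e S₁ T * e S₂ T)
  (hadd₂ : ∀ S T₁ T₂, e S (T₁ + T₂) = e S T₁ * e S T₂)
  (hgal : ∀ (g : absoluteGaloisGroup K) (S T : geomTorsion (W.baseChange K) ((p ^ 1 : ℕ) : ℤ)),
    g • e S T = e (g • S) (g • T))
  (halt : ∀ T, e T T = 1) (hnondeg : ∀ T, (∀ S, e S T = 1) → T = 0)
  (hτe : ∀ S T, liftAut τ (e S T) =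
    e ((isLiftOfAut_liftAut τ).torsionMap W ((p ^ 1 : ℕ) : ℤ) S)
      ((isLiftOfAut_liftAut τ).torsionMap W ((p ^ 1 : ℕ) : ℤ) T))

include halt hnondeg hτe in
/-- **LEVEL RAISING AT MINIMAL DEPTH on an X9 Heegner frame** — McCallum 1991 Prop. 5.2 (`C = {0}`) in the form the §6
bridge consumes, PROVED modulo Gross 3.7 (2) (`h37`), the Poitou–Tate package, [GZ86 III (3.1)] and the walk's local inputs
(all tree theorems at level `p^k`); X9 twin of `Swap.exists_conductor_levelIndex_ge_of_minDepth`; see the module docstring.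
[cite: McCallumLMS1991, §5 Prop. 5.2 and proof (pp. 304–306)] [cite: Jetchev2008, proof of Thm. 1.4 (p. 824)] -/
theorem exists_conductor_levelIndex_ge_of_minDepth_classX9 (h37 : GrossLMS1991.prop37_2_frobeniusCongruence)
    (hK : IsImaginaryQuadratic K)
    (hD3 : NumberField.discr K ≠ -3) (hD4 : NumberField.discr K ≠ -4)
    (hH : SatisfiesHeegnerHypothesis (W.conductorNorm ℤ) K) (hX9 : ClassX9 W p)
    (hHp : SatisfiesHeegnerHypothesis p K) (hτ1 : τ ≠ 1) (hττ : τ * τ = 1)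
    (Dt : ModularParametrizationData W (W.conductorNorm ℤ)) (β : ℤ) (ι : K →+* ℂ)
    [∀ j : ℕ, NumberField (ringClassField K ι j)]
    (inv : LocalInvariants K (p ^ 1)) (hperf : inv.IsPerfect) (hvan : inv.SumLocalTermEqZero)
    (hSC : inv.SelmerComplement) (hinv : inv.IsConjCompatible τ)
    (𝒯 : SelmerStructure ((W.baseChange K).torsionGaloisModule ((p ^ 1 : ℕ) : ℤ)))
    (h𝒯 : ∀ v : HeightOneSpectrum (𝓞 K), 𝒯 (Sum.inr v) =
      ⨅ (ℓ : ℕ) (_ : ℓ.Prime ∧ (ℓ : 𝓞 K) ∈ v.asIdeal),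
        ⨅ (w' : HeightOneSpectrum (𝓞 (ringClassField K ι ℓ)))
          (_ : w'.asIdeal.LiesOver v.asIdeal),
          letI := (adicCompletionOfLiesOver K (ringClassField K ι ℓ) v w').toAlgebra
          transverseSubgroup (GaloisRep.toLocal v ((W.baseChange K).torsionGaloisModule ((p ^ 1 : ℕ) : ℤ)))
            (w'.adicCompletion (ringClassField K ι ℓ)))
    (h𝒯σ : ∀ (c : ℕ), Squarefree c →
      (∀ q ∈ c.primeFactors, Zhang2014.IsKolyvaginPrime (W.conductorNorm ℤ) W K p q) →
      ∀ (v w : HeightOneSpectrum (𝓞 K)) (h : τ • v = w), v ∈ placesDividing K c →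
      ∀ x : galoisCohomology (((W.baseChange K).torsionGaloisModule ((p ^ 1 : ℕ) : ℤ)).toLocal
        (Sum.inr v : Place K)) 1,
      x ∈ 𝒯 (Sum.inr v) → conjActPlace W τ ((p ^ 1 : ℕ) : ℤ) h x ∈ 𝒯 (Sum.inr w))
    (h𝒯sd : ∀ (c : ℕ), Squarefree c →
      (∀ q ∈ c.primeFactors, Zhang2014.IsKolyvaginPrime (W.conductorNorm ℤ) W K p q) →
      ∀ v ∈ placesDividing K c,
      inv.dualTransported 𝒯 (weilDualIntertwining (W.baseChange K) (p ^ 1) e hμ hadd₁ hadd₂ hgal)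
        (Sum.inr v) = 𝒯 (Sum.inr v))
    (hloc : ∀ ℓ : ℕ, Zhang2014.IsKolyvaginPrime (W.conductorNorm ℤ) W K p ℓ →
      1 ≤ Zhang2014.kolyvaginIndex W p ℓ →
      ∀ (v : HeightOneSpectrum (𝓞 K)), (ℓ : 𝓞 K) ∈ v.asIdeal → ∀ (hfix : τ • v = v) (s : ℤ),
      (s = 1 ∨ s = -1) →
      ((W.baseChange K).kummerSelmerStructure ((p ^ 1 : ℕ) : ℤ) (Sum.inr v)).relIndex
        ((conjActPlace W τ ((p ^ 1 : ℕ) : ℤ) hfix - s • AddMonoidHom.id _).ker) = p ^ 1)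
    (hdisj : ∀ ℓ : ℕ, Zhang2014.IsKolyvaginPrime (W.conductorNorm ℤ) W K p ℓ →
      ∀ v : HeightOneSpectrum (𝓞 K), (ℓ : 𝓞 K) ∈ v.asIdeal →
      Disjoint ((W.baseChange K).kummerSelmerStructure ((p ^ 1 : ℕ) : ℤ) (Sum.inr v)) (𝒯 (Sum.inr v)))
    {n' : ℤ} (hcop' : IsCoprime (p : ℤ) n')
    (hGZ : ∀ (m : ℕ), Squarefree m →
      (∀ q ∈ m.primeFactors, Zhang2014.IsKolyvaginPrime (W.conductorNorm ℤ) W K p q) →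
      ∀ (dm : KolyvaginHeegnerData Dt β ι m)
      (γ : ringClassField K ι m ≃ₐ[ℚ] ringClassField K ι m), γ ∈ ringClassGal ι m →
      ∀ v : HeightOneSpectrum (𝓞 K), ¬ (W.baseChange K).HasGoodReductionAt v →
        n' • pointsMap (W.baseChange K) (v.adicCompletion K)
            (dm.toGeomPoints (pointGalHom W (ringClassField K ι m) γ dm.y)) ∈
          E0Receptacle (W.baseChange K) v ∧
        ∀ (ℓ : ℕ), ℓ ∈ m.primeFactors → ∀ (dm' : KolyvaginHeegnerData Dt β ι (m / ℓ))
          (hle : ringClassField K ι (m / ℓ) ≤ ringClassField K ι m),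
          n' • pointsMap (W.baseChange K) (v.adicCompletion K)
              (dm.toGeomPoints (pointGalHom W (ringClassField K ι m) γ
                (WeierstrassCurve.Affine.Point.map (W' := W)
                  ((RingClassField.inclusion ι hle).restrictScalars ℚ) dm'.y))) ∈
            E0Receptacle (W.baseChange K) v)
    {u : ℕ}
    (hmin : ∀ (c : ℕ), Squarefree c →
      (∀ q ∈ c.primeFactors, Zhang2014.IsKolyvaginPrime (W.conductorNorm ℤ) W K p q ∧
        1 + u ≤ Zhang2014.kolyvaginIndex W p q) →
      ∀ dc : KolyvaginHeegnerData Dt β ι c,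
      ∃ Q : (W.baseChange (ringClassField K ι c)).toAffine.Point, ((p ^ u : ℕ) : ℤ) • Q = dc.derivedPoint)
    {n₀ : ℕ} (hn₀ : Squarefree n₀)
    (hn₀K : ∀ q ∈ n₀.primeFactors, Zhang2014.IsKolyvaginPrime (W.conductorNorm ℤ) W K p q ∧
      1 + u ≤ Zhang2014.kolyvaginIndex W p q)
    (d₀ : KolyvaginHeegnerData Dt β ι n₀)
    (hd₀ : ¬ ∃ Q : (W.baseChange (ringClassField K ι n₀)).toAffine.Point,
      ((p ^ (u + 1) : ℕ) : ℤ) • Q = d₀.derivedPoint)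
    (m' : ℕ) :
    ∃ (n : ℕ) (d : KolyvaginHeegnerData Dt β ι n), Squarefree n ∧
      (∀ q ∈ n.primeFactors, Zhang2014.IsKolyvaginPrime (W.conductorNorm ℤ) W K p q ∧
        max m' (1 + u) ≤ Zhang2014.kolyvaginIndex W p q) ∧
      ¬ ∃ Q : (W.baseChange (ringClassField K ι n)).toAffine.Point,
        ((p ^ (u + 1) : ℕ) : ℤ) • Q = d.derivedPoint := by
  have hp : p.Prime := Fact.out
  have hD : NumberField.discr K < -4 := KolyvaginAssembly.discr_lt_neg_four hK ⟨hD3, hD4⟩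
  have hCM1 : phi_heegnerPointOfConductor_mem_range_map_ringClassField (W.conductorNorm ℤ) W K :=
    phi_heegnerPointOfConductor_mem_range_map_ringClassField_holds (W.conductorNorm ℤ) W K
  have hCM2 : exists_generator_ringClassGalOver K := exists_generator_ringClassGalOver_holds
  -- the invariant of the walk
  let Good : ℕ → Prop := fun n ↦ Squarefree n ∧
    (∀ q ∈ n.primeFactors, Zhang2014.IsKolyvaginPrime (W.conductorNorm ℤ) W K p q ∧
      1 + u ≤ Zhang2014.kolyvaginIndex W p q) ∧
    ∃ d : KolyvaginHeegnerData Dt β ι n, ¬ ∃ Q : (W.baseChange (ringClassField K ι n)).toAffine.Point,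
      ((p ^ (u + 1) : ℕ) : ℤ) • Q = d.derivedPoint
  set m₁ : ℕ := max m' (1 + u) with hm₁
  have hm₁1 : 1 ≤ m₁ := le_trans (by omega) (le_max_right _ _)
  -- ONE SWAP
  have hstep : ∀ n, Good n → ∀ ℓ₀ ∈ n.primeFactors, Zhang2014.kolyvaginIndex W p ℓ₀ < m₁ →
      ∃ ℓ' : ℕ, ℓ'.Prime ∧ ℓ' ∉ n.primeFactors ∧ m₁ ≤ Zhang2014.kolyvaginIndex W p ℓ' ∧
        Good (n / ℓ₀ * ℓ') := by
    rintro n ⟨hn, hnK, d, hd⟩ l₀ hl₀ -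
    have hn0 : n ≠ 0 := hn.ne_zero
    have hinert : ∀ (m : ℕ), m ∣ n → ∀ q ∈ m.primeFactors, (Ideal.span {(q : 𝓞 K)}).IsPrime :=
      fun m hm q hq ↦ (hnK q (Nat.primeFactors_mono hm hn0 hq)).1.2.2.2.2.1
    -- data at the divisors of `n`, the given `d` at `n`
    have hne : ∀ m : ℕ, m ∣ n → Nonempty (KolyvaginHeegnerData Dt β ι m) := fun m hm ↦
      nonempty_kolyvaginHeegnerData_of_grossCM hCM1 hCM2 hK hH Dt β ι d.dvd_sq_sub
        (hn.squarefree_of_dvd hm) (hinert m hm)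
    let data : (m : ℕ) → m ∣ n → KolyvaginHeegnerData Dt β ι m := fun m hm ↦
      if h : m = n then h ▸ d else (hne m hm).some
    have hdata : data n dvd_rfl = d := by simp [data]
    have hdvd : ∃ Q : (W.baseChange (ringClassField K ι n)).toAffine.Point,
        ((p ^ u : ℕ) : ℤ) • Q = (data n dvd_rfl).derivedPoint := by
      rw [hdata]; exact hmin n hn hnK d
    have hndvd : ¬ ∃ Q : (W.baseChange (ringClassField K ι n)).toAffine.Point,
        ((p ^ (u + 1) : ℕ) : ℤ) • Q = (data n dvd_rfl).derivedPoint := by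
      rw [hdata]; exact hd
    -- the `λ'` half
    obtain ⟨ℓ', v', v₀, t, -, hKol', hjℓ', hℓ'n, hv', hv₀, ht, htv', hxup⟩ :=
      exists_swapPrime_classX9 W τ p e hμ hadd₁ hadd₂ hgal halt hnondeg hτe hK hD3 hD4 hH hX9 hHp hτ1 hττ Dt β ι
        inv hperf hvan hSC hinv 𝒯 h𝒯σ h𝒯sd hloc (j := m₁ - 1) (by omega) n hn hnK hl₀ data hdvd hndvd
    rw [hdata] at hxup
    have hm₁ℓ' : m₁ ≤ Zhang2014.kolyvaginIndex W p ℓ' := by omega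
    have h1u : 1 + u ≤ Zhang2014.kolyvaginIndex W p ℓ' := le_trans (le_max_right _ _) hm₁ℓ'
    -- compatible data and the `λ₀` half
    obtain ⟨d', d'', hσ, hS, hS', hemb, hσ₁, hS₁, hS₁', hemb₁⟩ :=
      exists_compatible_data_triple_of_grossCM hK hD hH p Dt β ι hn (fun q hq ↦ (hnK q hq).1) hl₀
        hKol' hℓ'n d
    have hres := not_dvd_of_swap_classX9 W τ p e hμ hadd₁ hadd₂ hgal halt hnondeg hτe h37 hK hD3 hD4 hH hX9 hHp
      hτ1 hττ Dt β ι inv hperf hvan hSC hinv 𝒯 h𝒯 h𝒯σ h𝒯sd hloc hdisj hcop' hGZ hmin hn hnK hl₀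
      hKol' h1u hℓ'n hv' hv₀ d d' hσ hS hS' hemb hxup t ht htv' d'' hσ₁ hS₁ hS₁' hemb₁
    refine ⟨ℓ', hKol'.1, hℓ'n, hm₁ℓ', squarefree_swap hn hl₀ hKol'.1 hℓ'n, ?_, d'', hres⟩
    intro q hq
    rw [primeFactors_swap hn hl₀ hKol'.1, Finset.mem_insert, Finset.mem_erase] at hq
    rcases hq with rfl | ⟨-, hq⟩
    · exact ⟨hKol', h1u⟩
    · exact hnK q hq
  -- THE WALK
  obtain ⟨n, ⟨hn, hnK, d, hd⟩, hM⟩ := exists_forall_le_index_of_swapStep (Zhang2014.kolyvaginIndex W p)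
    m₁ Good (fun n h ↦ h.1) hstep ⟨hn₀, hn₀K, d₀, hd₀⟩
  exact ⟨n, d, hn, fun q hq ↦ ⟨(hnK q hq).1, hM q hq⟩, hd⟩

/-! ### §2 `SwapX9` from the three named Literature facts -/


/-- **`SwapX9` from three named Literature facts** (Kolyvagin's prime swap on every X9 Heegner frame, in the `hswapX9`
binder shape of `jetchevX9_of_swapX9_of_namedFacts`): brick 4 with the Poitou–Tate package, a Weil datum, the global intrinsic
transverse family and its four local facts, [GZ86 III (3.1)] (guarded, image-free) all supplied by name, Prop. 4.4 from
Gross 3.7 (2). [cite: McCallumLMS1991, §5 Prop. 5.2 (p. 304)] [cite: Jetchev2008, Lemma 5.1, Lemma 5.2 (iii), Rem. 6.2]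
[cite: GrossZagier1986, III (3.1)] -/
theorem swapX9_of_namedFacts
    (h37 : GrossLMS1991.prop37_2_frobeniusCongruence)
    (hPT : ∀ (K : Type) [Field K] [NumberField K], poitouTate_selmerStructure_duality_conj K)
    (hF1 : Gross1991_heegnerPoint_sub_ratTorsion_mem_E0_imageFree) :
    ∀ (W : WeierstrassCurve ℚ) [W.IsElliptic] [W.IsGloballyMinimal] [NeZero (W.conductorNorm ℤ)],
        ∀ (K : Type) [Field K] [NumberField K], IsImaginaryQuadratic K →
        NumberField.discr K ≠ -3 → NumberField.discr K ≠ -4 →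
        SatisfiesHeegnerHypothesis (W.conductorNorm ℤ) K →
        ∀ (p : ℕ) [Fact p.Prime], ClassX9 W p → SatisfiesHeegnerHypothesis p K →
        ∀ (Dt : ModularParametrizationData W (W.conductorNorm ℤ)) (β : ℤ) (ι : K →+* ℂ)
          (d₁ : KolyvaginHeegnerData Dt β ι 1), ¬ IsOfFinAddOrder d₁.derivedPoint →
        ∀ (M e : ℕ) (n : ℕ) (d : KolyvaginHeegnerData Dt β ι n), Squarefree n →
          (∀ ℓ ∈ n.primeFactors, Zhang2014.IsKolyvaginPrime (W.conductorNorm ℤ) W K p ℓ ∧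
            M + 1 ≤ Zhang2014.kolyvaginIndex W p ℓ) →
          (∀ (n' : ℕ) (d' : KolyvaginHeegnerData Dt β ι n'), Squarefree n' →
            (∀ ℓ ∈ n'.primeFactors, Zhang2014.IsKolyvaginPrime (W.conductorNorm ℤ) W K p ℓ ∧
              M + 1 ≤ Zhang2014.kolyvaginIndex W p ℓ) →
            Koly.PDiv d' p M) →
          ¬ Koly.PDiv d p (M + 1) →
          ∃ (n' : ℕ) (d' : KolyvaginHeegnerData Dt β ι n'), Squarefree n' ∧
            (∀ ℓ ∈ n'.primeFactors, Zhang2014.IsKolyvaginPrime (W.conductorNorm ℤ) W K p ℓ ∧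
              e ≤ Zhang2014.kolyvaginIndex W p ℓ) ∧
            ¬ Koly.PDiv d' p (M + 1) := by
  intro W _ _ _ K _ _ hK hD3 hD4 hH p _ hX9 hHp Dt β ι _ _ M eB n₀ d₀ hn₀ hn₀K hmin hd₀
  have hp2 : p ≠ 2 := hX9.ne_two
  have hirr : W.HasIrreducibleModPGaloisRep p := hX9.irr
  -- frame bookkeeping: `M + 1 = 1 + M`
  have hn₀K' : ∀ q ∈ n₀.primeFactors, Zhang2014.IsKolyvaginPrime (W.conductorNorm ℤ) W K p q ∧
      1 + M ≤ Zhang2014.kolyvaginIndex W p q := fun q hq ↦ ⟨(hn₀K q hq).1, by rw [Nat.add_comm]; exact (hn₀K q hq).2⟩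
  have hmin' : ∀ (c : ℕ), Squarefree c →
      (∀ q ∈ c.primeFactors, Zhang2014.IsKolyvaginPrime (W.conductorNorm ℤ) W K p q ∧
        1 + M ≤ Zhang2014.kolyvaginIndex W p q) →
      ∀ dc : KolyvaginHeegnerData Dt β ι c,
      ∃ Q : (W.baseChange (ringClassField K ι c)).toAffine.Point, ((p ^ M : ℕ) : ℤ) • Q = dc.derivedPoint :=
    fun c hc hcK dc ↦ hmin c dc hc (fun q hq ↦ ⟨(hcK q hq).1, by rw [Nat.add_comm]; exact (hcK q hq).2⟩)
  have hp : p.Prime := Fact.out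
  have hD : NumberField.discr K < -4 := KolyvaginAssembly.discr_lt_neg_four hK ⟨hD3, hD4⟩
  haveI : ∀ j : ℕ, NumberField (ringClassField K ι j) := numberField_ringClassField K hK ι
  obtain ⟨τ, hτ⟩ := exists_algEquiv_ne_one_of_isImaginaryQuadratic K hK
  have hττ : τ * τ = 1 := mul_self_eq_one_of_isImaginaryQuadratic hK τ
  -- instances at level `p`
  haveI : NeZero (p ^ 1) := ⟨pow_ne_zero 1 hp.ne_zero⟩
  haveI : Finite (geomTorsion (W.baseChange K) ((p ^ 1 : ℕ) : ℤ)) :=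
    finite_geomTorsion_of_neZero (W.baseChange K) (p ^ 1)
  -- the Poitou–Tate package and a `τ`-equivariant Weil datum at level `p`
  obtain ⟨inv, hperf, hvan, -, hSC, hconj⟩ := hPT K (p ^ 1)
  have h2 : 2 ≤ p ^ 1 := by rw [pow_one]; exact hp.two_le
  obtain ⟨e, hμ, hadd₁, hadd₂, hgal, halt, hnondeg, hτe⟩ := exists_weilDatum_liftAut W τ (p ^ 1) h2
  -- the global intrinsic transverse family at level `p` and its local facts
  obtain ⟨𝒯, h𝒯, -⟩ := Walk.exists_globalTransverseFamily W ι ((p ^ 1 : ℕ) : ℤ)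
  have h𝒯σ' : ∀ (c : ℕ), Squarefree c →
      (∀ q ∈ c.primeFactors, Zhang2014.IsKolyvaginPrime (W.conductorNorm ℤ) W K p q) →
      ∀ (v w : HeightOneSpectrum (𝓞 K)) (h : τ • v = w), v ∈ placesDividing K c →
      ∀ x : galoisCohomology (((W.baseChange K).torsionGaloisModule ((p ^ 1 : ℕ) : ℤ)).toLocal
        (Sum.inr v : Place K)) 1,
      x ∈ 𝒯 (Sum.inr v) → conjActPlace W τ ((p ^ 1 : ℕ) : ℤ) h x ∈ 𝒯 (Sum.inr w) :=
    fun c hc _ v w h hv x hx ↦ Walk.globalTransverse_conjActPlace_mem h𝒯 τ hc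
      (forall_conjActPlace_mem_of_eq_iInf_transverseSubgroup W hK ι τ _ c) v w h hv x hx
  have h𝒯sd' : ∀ (c : ℕ), Squarefree c →
      (∀ q ∈ c.primeFactors, Zhang2014.IsKolyvaginPrime (W.conductorNorm ℤ) W K p q) →
      ∀ v ∈ placesDividing K c,
      inv.dualTransported 𝒯 (weilDualIntertwining (W.baseChange K) (p ^ 1) e hμ hadd₁ hadd₂ hgal)
        (Sum.inr v) = 𝒯 (Sum.inr v) :=
    fun c hc hcK ↦ Walk.globalTransverse_dualTransported_eq (ι := ι) h𝒯 hc
      (fun 𝒯c h𝒯c inv' hperf' w' hw' ↦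
        RingClassTransverse.dualTransported_eq_of_localTransverseFamily W K hK hD ι p hp2 1 le_rfl c hc
          hcK (fun ℓ hℓ ↦ (hcK ℓ hℓ).2.2.2.2.2) 𝒯c h𝒯c e hμ hadd₁ hadd₂ hgal halt hnondeg inv' hperf' w' hw')
      inv hperf
  have hloc' : ∀ ℓ : ℕ, Zhang2014.IsKolyvaginPrime (W.conductorNorm ℤ) W K p ℓ →
      1 ≤ Zhang2014.kolyvaginIndex W p ℓ →
      ∀ (v : HeightOneSpectrum (𝓞 K)), (ℓ : 𝓞 K) ∈ v.asIdeal → ∀ (hfix : τ • v = v) (s : ℤ),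
      (s = 1 ∨ s = -1) →
      ((W.baseChange K).kummerSelmerStructure ((p ^ 1 : ℕ) : ℤ) (Sum.inr v)).relIndex
        ((conjActPlace W τ ((p ^ 1 : ℕ) : ℤ) hfix - s • AddMonoidHom.id _).ker) = p ^ 1 :=
    fun ℓ hℓ hk v hv hfix s hs ↦
      kolyvaginLocalTerm_of_poitouTate hPT W K hK τ hτ p 1 hp2 le_rfl ℓ hℓ hk v hv hfix s hs
  have hdisj' : ∀ ℓ : ℕ, Zhang2014.IsKolyvaginPrime (W.conductorNorm ℤ) W K p ℓ →
      ∀ v : HeightOneSpectrum (𝓞 K), (ℓ : 𝓞 K) ∈ v.asIdeal →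
      Disjoint ((W.baseChange K).kummerSelmerStructure ((p ^ 1 : ℕ) : ℤ) (Sum.inr v)) (𝒯 (Sum.inr v)) :=
    fun ℓ hℓ v hv ↦ Walk.globalTransverse_disjoint_kummer h𝒯
      (P := fun ℓ ↦ Zhang2014.IsKolyvaginPrime (W.conductorNorm ℤ) W K p ℓ)
      (fun ℓ hℓ w hw ↦ Walk.disjoint_kummer_iInf_transverseSubgroup W K hK hD ι 1 hℓ w hw)
      (fun ℓ hℓ ↦ hℓ.1) ℓ hℓ v hv
  -- [GZ86 III (3.1)] (guarded) from the IMAGE-FREE fact; Prop. 4.4 from Gross 3.7 (2) inside the bricks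
  obtain ⟨n', hcop', hGZ'⟩ := HeegnerE0ImageFree.hGZ_of_Gross1991_imageFree hF1 W K hK hD3 hD4 hH p hp2 hirr Dt β ι
  obtain ⟨n, d, hn, hnK, hd⟩ := exists_conductor_levelIndex_ge_of_minDepth_classX9 W τ p e hμ hadd₁ hadd₂ hgal halt
    hnondeg hτe h37 hK hD3 hD4 hH hX9 hHp hτ hττ Dt β ι inv hperf hvan hSC (hconj τ)
    𝒯 h𝒯 h𝒯σ' h𝒯sd' hloc' hdisj' hcop' hGZ' hmin' hn₀ hn₀K' d₀ hd₀ eB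
  exact ⟨n, d, hn, fun q hq ↦ ⟨(hnK q hq).1, le_trans (le_max_left _ _) (hnK q hq).2⟩, hd⟩

end Summit.BirchSwinnertonDyer.Rank1Residual.JET.Split

end
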